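import Summits.BirchSwinnertonDyer.Rank1Residual.X4.EigenSymbOfFunction
import HarnessLib

/-!
# The `ℓ`-OLD eigensymbol from a LEVEL-`M` eigen-function: (OLD) reduced to its published content (Ribet's level-`M` eigensymbol + Ihara's non-vanishing) (cell `b2b-bsdres`, seat additive-p4 gen 23, line V42, file K9)

HONEST FRAMING (verbatim, cell `b2b-bsdres`): the goal of the cell is to DELETE the COMBINATION-SHAPED
residual classes for ALL analytic-rank `≤ 1` curves over `ℚ` — "full BSD formula for every rank `≤ 1`
curve in class `C`" assembled STRICTLY from published theorems — so that the rank-`≤ 1` remainder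
becomes exactly the CONSTRUCTION-SHAPED classes, which are TYPED (missing-input Props), NOT attempted;
this is not "finishing BSD". This file: research-route KERNEL ALGEBRA (the `ℓ`-stabilisation of a
weight-`2` eigen-function at the level of the tree's `Sym⁰` modular symbols); nothing asserted about
any curve; no named fact; nothing booked; X4 stays CONSTRUCTION-SHAPED.

## What is proved

Gen 23's displayed hypothesis **(OLD) `HasOldEigenPlusSymb k (M ℓ) θ' ℓ w μ`** asks for a function
`μ : ℚ → k` whose `ℓ`-old combination `ψ = μ − w·μ∘[ℓ]` has its symbol in the `θ'`-eigen plus subspace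
of `Symb_{Γ₀(Mℓ)}(Sym⁰ k)` and is non-zero. This file proves the STABILISATION half of that statement
as pure algebra: if `μ` is `1`-periodic, even, with symbol in `Symb_{Γ₀(M)}(Sym⁰ k)` and Hecke-eigen
at level `M` with system `θ` (MTT relation at `q ∤ M`, Atkin–Lehner relation at `q ∣ M`), `ℓ ∤ M` a
prime, and `α, w ∈ k` with `α² − θ(ℓ) α + ℓ = 0`, `w α = 1` (the root `α ≡ a_ℓ(f)`, `w = α⁻¹`; for
`θ(ℓ) = ε(ℓ+1)`, `α = w = ε`), then
**`IsEigenPlusSymb k (M * ℓ) θ' (potSymbOf (μ − w·μ∘[ℓ]))`** with `θ' = θ` off `ℓ` and `θ'(ℓ) = α`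
(`isEigenPlusSymb_oldShape`; minus twin `isEigenMinusSymb_oldShape`). Ingredients: the re-indexing
`Σ_{j<q} μ((s + ℓj)/q) = Σ_{j<q} μ((s + j)/q)` for `gcd(ℓ, q) = 1` (`sum_range_mulLeft`), hence the
Hecke / Atkin–Lehner relations of `μ∘[ℓ]` (`heckeRel_mulLeft`, `atkinRel_mulLeft`); `Γ₀(Mℓ)`-invariance
of the symbol of `μ∘[ℓ]` from `δ_ℓ Γ₀(Mℓ) δ_ℓ⁻¹ ⊆ Γ₀(M)` (tree `deltaMat_mul_eq`, `deltaConj_mem_gamma0`);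
the `U_ℓ`-relation of `ψ` at level `Mℓ` from the `T_ℓ`-relation of `μ` at level `M`
(`Σ_{j<ℓ} ψ((r+j)/ℓ) = (θ(ℓ) − wℓ) μ(r) − μ(ℓr) = α ψ(r)`).

CONSEQUENCE for the typer of (OLD) (`hasOldEigenPlusSymb_of_levelLower`): (OLD) at level `N = Mℓ`
follows from (i) a `1`-periodic even `μ` with `IsEigenPlusSymb k M θ (potSymbOf μ)` and the
function-level relations — for `θ = θ̄_f` off `ℓ`, `θ(ℓ) ≡ ε(ℓ+1)`: the reduced canonically-normalised
symbol of the level-`M` form `g` given by RIBET 1990 Thm. 1.1 (`diamond1995_refinedSerre`) + the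
`U`-stabilisations at the other primes of `N` + Edixhoven 1992 at `T_p` — and (ii) `μ − w μ∘[ℓ] ≢ 0`
— IHARA's lemma (Ribet 1984 Thm. 4.1). Nothing else.

## References

* B. Mazur, J. Tate, J. Teitelbaum, Invent. Math. 84 (1986), §I.4 (4.2), §I.10. [cite: MazurTateTeitelbaum1986Invent, §I.4 (4.2) and §I.10]
* G. Shimura, *Introduction to the arithmetic theory of automorphic functions* (1971), §3.4. [cite: Shimura1971, §3.4]
* K. A. Ribet, Invent. Math. 100 (1990), Thm. 1.1; Proc. ICM 1983 (1984), Thm. 4.1. [cite: Ribet1990, Thm. 1.1] [cite: Ribet1984ICM, Thm. 4.1]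
-/

noncomputable section

open scoped MatrixGroups ModularForm

open CongruenceSubgroup Finset Matrix

open Literature.NumberTheory.EllipticCurves Literature.NumberTheory.EllipticCurves.ModularForms
  Literature.NumberTheory.EllipticCurves.ModularForms.HidaCohomology

namespace Summit.BirchSwinnertonDyer.Rank1Residual.LevelLowering

variable {k : Type*} [CommRing k] {μ : ℚ → k}

/-! ### §1 Re-indexing by a unit and the Hecke relations of `μ∘[ℓ]` -/

section Reindex

omit [CommRing k] in
/-- A periodic `μ` evaluated at `s + n/q` only sees `n mod q`. [folklore] -/
theorem IsPeriodic.apply_add_natCast_div (hμ : IsPeriodic μ) {q : ℕ} [NeZero q] (s : ℚ) (n : ℕ) :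
    μ (s + (n : ℚ) / q) = μ (s + (((n : ZMod q).val : ℕ) : ℚ) / q) := by
  rw [ZMod.val_natCast]
  have hq : (q : ℚ) ≠ 0 := by exact_mod_cast NeZero.ne q
  have hk : ((n % q : ℕ) : ℚ) = (n : ℚ) - (q : ℚ) * ((n / q : ℕ) : ℚ) := by
    have h' : ((n % q : ℕ) : ℚ) + (q : ℚ) * ((n / q : ℕ) : ℚ) = (n : ℚ) := by
      exact_mod_cast Nat.mod_add_div n q
    linarith
  refine hμ.eq_of_eq_add_int ((n / q : ℕ) : ℤ) ?_
  rw [Int.cast_natCast, hk]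
  field_simp
  ring

/-- **Re-indexing by a unit**: `Σ_{j<q} μ((s + ℓj)/q) = Σ_{j<q} μ((s + j)/q)` for `μ` periodic and
`gcd(ℓ, q) = 1` (`j ↦ ℓ j` permutes `ℤ/q`). [cite: MazurTateTeitelbaum1986Invent, §I.4 (4.2)] -/
theorem sum_range_mulLeft (hμ : IsPeriodic μ) {q : ℕ} [NeZero q] {ℓ : ℕ} (hℓ : ℓ.Coprime q) (s : ℚ) :
    ∑ j ∈ Finset.range q, μ ((s + ℓ * j) / q) = ∑ j ∈ Finset.range q, μ ((s + j) / q) := by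
  have hu : IsUnit ((ℓ : ℕ) : ZMod q) := (ZMod.isUnit_iff_coprime ℓ q).mpr hℓ
  obtain ⟨u, hu'⟩ := hu
  -- both sides as sums over `ℤ/q`
  have hL : ∑ j ∈ Finset.range q, μ ((s + ℓ * j) / q) =
      ∑ v : ZMod q, μ (s / q + (((ℓ * v.val : ℕ) : ZMod q).val : ℚ) / q) := by
    rw [← Fin.sum_univ_eq_sum_range, ← sum_zmod_val_eq_sum_fin q (fun j ↦ μ ((s + ℓ * j) / q))]
    refine Finset.sum_congr rfl fun v _ ↦ ?_
    rw [← hμ.apply_add_natCast_div (s / q) (ℓ * v.val)]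
    push_cast
    ring_nf
  have hR : ∑ j ∈ Finset.range q, μ ((s + j) / q) = ∑ v : ZMod q, μ (s / q + (v.val : ℚ) / q) := by
    rw [← Fin.sum_univ_eq_sum_range, ← sum_zmod_val_eq_sum_fin q (fun j ↦ μ ((s + j) / q))]
    refine Finset.sum_congr rfl fun v _ ↦ ?_
    ring_nf
  rw [hL, hR]
  have hcast : ∀ v : ZMod q, ((ℓ * v.val : ℕ) : ZMod q) = (u : ZMod q) * v := fun v ↦ by
    rw [Nat.cast_mul, ZMod.natCast_zmod_val, hu']
  simp_rw [hcast]
  exact Fintype.sum_equiv (u.mulLeft) _ _ fun v ↦ rfl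

/-- **`μ∘[ℓ]` satisfies the MTT Hecke relation of `μ`** at every `q` prime to `ℓ`.
[cite: MazurTateTeitelbaum1986Invent, §I.4 (4.2)] -/
theorem heckeRel_mulLeft (hμ : IsPeriodic μ) {q : ℕ} [NeZero q] {ℓ : ℕ} (hℓ : ℓ.Coprime q) {a : k}
    (h : HeckeRel μ q a) : HeckeRel (fun r ↦ μ (ℓ * r)) q a := by
  intro r
  have h1 : ∑ j ∈ Finset.range q, μ (ℓ * ((r + j) / q)) = ∑ j ∈ Finset.range q, μ ((ℓ * r + j) / q) := by
    rw [← sum_range_mulLeft hμ hℓ (ℓ * r)]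
    refine Finset.sum_congr rfl fun j _ ↦ ?_
    ring_nf
  simp only
  rw [h1, show (ℓ : ℚ) * (q * r) = q * (ℓ * r) by ring]
  exact h (ℓ * r)

/-- **`μ∘[ℓ]` satisfies the Atkin–Lehner relation of `μ`** at every `q` prime to `ℓ`.
[cite: MazurTateTeitelbaum1986Invent, §I.4 (4.2)] -/
theorem atkinRel_mulLeft (hμ : IsPeriodic μ) {q : ℕ} [NeZero q] {ℓ : ℕ} (hℓ : ℓ.Coprime q) {a : k}
    (h : ∀ r : ℚ, ∑ j ∈ Finset.range q, μ ((r + j) / q) = a * μ r) (r : ℚ) :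
    ∑ j ∈ Finset.range q, μ (ℓ * ((r + j) / q)) = a * μ (ℓ * r) := by
  have h1 : ∑ j ∈ Finset.range q, μ (ℓ * ((r + j) / q)) = ∑ j ∈ Finset.range q, μ ((ℓ * r + j) / q) := by
    rw [← sum_range_mulLeft hμ hℓ (ℓ * r)]
    refine Finset.sum_congr rfl fun j _ ↦ ?_
    ring_nf
  rw [h1, h (ℓ * r)]

/-- **The `U_ℓ`-sum of `μ∘[ℓ]` is `ℓ·μ`**: `Σ_{j<ℓ} μ(ℓ (r+j)/ℓ) = Σ_{j<ℓ} μ(r + j) = ℓ μ(r)`.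
[cite: MazurTateTeitelbaum1986Invent, §I.10] -/
theorem sum_range_mulLeft_self (hμ : IsPeriodic μ) {ℓ : ℕ} (hℓ : ℓ ≠ 0) (r : ℚ) :
    ∑ j ∈ Finset.range ℓ, μ (ℓ * ((r + j) / ℓ)) = (ℓ : k) * μ r := by
  have hℓq : (ℓ : ℚ) ≠ 0 := by exact_mod_cast hℓ
  have hterm : ∀ j ∈ Finset.range ℓ, μ (ℓ * ((r + j) / ℓ)) = μ r := fun j _ ↦ by
    rw [mul_div_cancel₀ _ hℓq]
    exact_mod_cast hμ r j
  rw [Finset.sum_congr rfl hterm, Finset.sum_const, Finset.card_range, nsmul_eq_mul]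

end Reindex

/-! ### §2 The symbol of `μ∘[ℓ]`: `δ_ℓ`-transport and `Γ₀(Mℓ)`-invariance -/

section Delta

variable (μ) {ℓ : ℕ} [Fact ℓ.Prime]

/-- `potOf (μ∘[ℓ]) x = potOf μ (δ_ℓ x)` with `δ_ℓ = diag(ℓ, 1)`. [cite: Shimura1971, §3.4] -/
theorem potOf_mulLeft (x : P1Q) :
    potOf (fun r ↦ μ (ℓ * r)) x = potOf μ (P1Q.act (deltaMat ℓ) x) := by
  rcases P1Q.infty_or_ofRat x with rfl | ⟨r, rfl⟩
  · rw [act_deltaMat_infty, potOf_infty, potOf_infty]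
  · rw [act_deltaMat_ofRat, potOf_ofRat, potOf_ofRat]

variable {μ}

/-- **`Γ₀(Mℓ)`-invariance of the symbol of `μ∘[ℓ]`** from `Γ₀(M)`-invariance of the symbol of `μ`
(`δ_ℓ γ = γ' δ_ℓ` with `γ' ∈ Γ₀(M)` for `γ ∈ Γ₀(Mℓ)`). [cite: Shimura1971, §3.4] -/
theorem potSymbOf_mulLeft_mem_Symb {M : ℕ} (S S' : Set (Matrix (Fin 2) (Fin 2) ℤ))
    (hμ : potSymbOf μ ∈ (CoeffActionOn.symPowOn S 0 k).Symb (Gamma0 M)) :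
    potSymbOf (fun r ↦ μ (ℓ * r)) ∈ (CoeffActionOn.symPowOn S' 0 k).Symb (Gamma0 (M * ℓ)) := by
  have hℓ0 : ℓ ≠ 0 := (Fact.out : ℓ.Prime).ne_zero
  rw [potSymbOf_mem_Symb_iff] at hμ ⊢
  intro γ hγ x y
  have hdvd := dvd_entry_of_mem_gamma0_mul hγ
  have hγ' : deltaConj γ hdvd ∈ Gamma0 M := deltaConj_mem_gamma0 hℓ0 hγ
  have hdetδ : (deltaMat ℓ).det ≠ 0 := by rw [det_deltaMat]; exact_mod_cast hℓ0
  have hdetγ : (γ : Matrix (Fin 2) (Fin 2) ℤ).det ≠ 0 := by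
    rw [Matrix.SpecialLinearGroup.det_coe]; exact one_ne_zero
  have hdetγ' : ((deltaConj γ hdvd : SL(2, ℤ)) : Matrix (Fin 2) (Fin 2) ℤ).det ≠ 0 := by
    rw [Matrix.SpecialLinearGroup.det_coe]; exact one_ne_zero
  have hmove : ∀ z : P1Q, P1Q.act (deltaMat ℓ) (P1Q.act (γ : Matrix (Fin 2) (Fin 2) ℤ) z) =
      P1Q.act ((deltaConj γ hdvd : SL(2, ℤ)) : Matrix (Fin 2) (Fin 2) ℤ) (P1Q.act (deltaMat ℓ) z) :=
    fun z ↦ by rw [P1Q.act_act hdetδ hdetγ, deltaMat_mul_eq γ hdvd, ← P1Q.act_act hdetγ' hdetδ]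
  rw [potOf_mulLeft, potOf_mulLeft, potOf_mulLeft, potOf_mulLeft, hmove, hmove]
  exact hμ _ hγ' _ _

end Delta

/-! ### §3 The `ℓ`-old eigensymbol -/

section OldShape

variable {M : ℕ} {ℓ : ℕ} [Fact ℓ.Prime]

/-- The Hecke relation is linear: `μ − w ν`. [folklore] -/
private theorem heckeRel_sub_smul {ν : ℚ → k} {q : ℕ} {a : k} (w : k) (hμ : HeckeRel μ q a)
    (hν : HeckeRel ν q a) : HeckeRel (fun r ↦ μ r - w * ν r) q a := fun r ↦ by
  have h := congrArg₂ (fun x y ↦ x - w * y) (hμ r) (hν r)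
  simp only [Finset.sum_sub_distrib, Finset.mul_sum, mul_add] at h ⊢
  linear_combination h

/-- **THE `ℓ`-OLD EIGENSYMBOL (level and Hecke part).** Let `μ : ℚ → k` be `1`-periodic with symbol in
`Symb_{Γ₀(M)}(Sym⁰ k)`, satisfying the MTT Hecke relation `Σ_j μ((r+j)/q) + μ(qr) = θ(q) μ(r)` at every
prime `q ∤ M` and the Atkin–Lehner relation `Σ_j μ((r+j)/q) = θ(q) μ(r)` at every prime `q ∣ M`; let
`ℓ ∤ M` be prime and `α, w ∈ k` with `α² − θ(ℓ) α + ℓ = 0`, `w α = 1`. Then the symbol of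
`ψ = μ − w μ∘[ℓ]` lies in `Symb_{Γ₀(Mℓ)}(Sym⁰ k)` and is Hecke-eigen at EVERY prime with system
`θ' = θ` off `ℓ`, `θ'(ℓ) = α` (the symbol of the `ℓ`-stabilised form `g − (ℓ/α)·g(ℓ·)`,
Mazur–Tate–Teitelbaum §I.10, written for `Sym⁰ k`). [cite: MazurTateTeitelbaum1986Invent, §I.4 (4.2) and §I.10]
[cite: Shimura1971, §3.4] -/
theorem oldShape_mem_Symb_and_hecke (hper : IsPeriodic μ)
    (hΓ : potSymbOf μ ∈ (CoeffActionOn.symPowOn (sigma0Set M) 0 k).Symb (Gamma0 M))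
    (θ : ℕ → k) (hT : ∀ q : ℕ, q.Prime → ¬ q ∣ M → HeckeRel μ q (θ q))
    (hU : ∀ q : ℕ, q.Prime → q ∣ M → ∀ r : ℚ, ∑ j ∈ Finset.range q, μ ((r + j) / q) = θ q * μ r)
    (hℓM : ¬ ℓ ∣ M) {α w : k} (hα : α ^ 2 - θ ℓ * α + ℓ = 0) (hw : w * α = 1)
    (θ' : ℕ → k) (hθ' : ∀ q : ℕ, q ≠ ℓ → θ' q = θ q) (hθ'ℓ : θ' ℓ = α) :
    (potSymbOf fun r ↦ μ r - w * μ (ℓ * r)) ∈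
        (CoeffActionOn.symPowOn (sigma0Set (M * ℓ)) 0 k).Symb (Gamma0 (M * ℓ)) ∧
      ∀ (q : ℕ) [NeZero q], q.Prime →
        (CoeffActionOn.symPowOn (sigma0Set (M * ℓ)) 0 k).hecke (M * ℓ) q
            (potSymbOf fun r ↦ μ r - w * μ (ℓ * r)) =
          θ' q • potSymbOf fun r ↦ μ r - w * μ (ℓ * r) := by
  have hℓp : ℓ.Prime := Fact.out
  -- the symbol of `ψ` is `Φ − w • Φ_ℓ`, both members of `Symb Γ₀(Mℓ)`
  have hsplit : (potSymbOf fun r ↦ μ r - w * μ (ℓ * r)) =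
      potSymbOf μ - w • potSymbOf (fun r ↦ μ (ℓ * r)) := by
    funext x y i
    simp only [potSymbOf_apply, Pi.sub_apply, Pi.smul_apply, smul_eq_mul]
    rcases P1Q.infty_or_ofRat x with rfl | ⟨r, rfl⟩ <;> rcases P1Q.infty_or_ofRat y with rfl | ⟨s, rfl⟩ <;>
      simp only [potOf_infty, potOf_ofRat] <;> ring
  refine ⟨?_, fun q _ hq ↦ ?_⟩
  · rw [hsplit]
    have h1 : potSymbOf μ ∈ (CoeffActionOn.symPowOn (sigma0Set (M * ℓ)) 0 k).Symb (Gamma0 (M * ℓ)) := by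
      rw [potSymbOf_mem_Symb_iff] at hΓ ⊢
      exact fun γ hγ x y ↦ hΓ γ (mem_gamma0_of_mem_gamma0_mul hγ) x y
    exact sub_mem h1 (Submodule.smul_mem _ w (potSymbOf_mulLeft_mem_Symb _ _ hΓ))
  · haveI : Fact q.Prime := ⟨hq⟩
    haveI : NeZero q := ⟨hq.ne_zero⟩
    by_cases hqℓ : q = ℓ
    · -- `U_ℓ` at level `Mℓ`
      subst hqℓ
      refine hecke_potSymbOf_of_atkinRel _ (dvd_mul_left q M) fun r ↦ ?_
      have hTℓ := hT q hℓp hℓM r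
      simp only [Finset.sum_sub_distrib, ← Finset.mul_sum, sum_range_mulLeft_self hper hℓp.ne_zero]
      rw [hθ'ℓ]
      have e1 : ∑ j ∈ Finset.range q, μ ((r + j) / q) = θ q * μ r - μ (q * r) :=
        eq_sub_of_add_eq hTℓ
      rw [e1]
      have hθq : θ q = α + q * w := by linear_combination (-w) * hα - (θ q - α) * hw
      rw [hθq]
      linear_combination (μ (q * r)) * hw
    · have hcop : ℓ.Coprime q := (Nat.coprime_primes hℓp hq).mpr (Ne.symm hqℓ)
      rw [hθ' q hqℓ]
      by_cases hqM : q ∣ M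
      · exact hecke_potSymbOf_of_atkinRel _ (hqM.mul_right ℓ) fun r ↦ by
          have h1 := hU q hq hqM r
          have h2 := atkinRel_mulLeft hper hcop (hU q hq hqM) r
          simp only [Finset.sum_sub_distrib, ← Finset.mul_sum, h1, h2]
          ring
      · have hqMℓ : ¬ q ∣ M * ℓ := fun h ↦ by
          rcases (Nat.Prime.dvd_mul hq).mp h with h' | h'
          · exact hqM h'
          · exact hqℓ ((Nat.prime_dvd_prime_iff_eq hq hℓp).mp h')
        exact hecke_potSymbOf_of_heckeRel _ hqMℓ
          (heckeRel_sub_smul w (hT q hq hqM) (heckeRel_mulLeft hper hcop (hT q hq hqM)))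


/-- **THE `ℓ`-OLD EIGEN-PLUS SYMBOL** (`μ` even): `IsEigenPlusSymb k (M * ℓ) θ' (potSymbOf (μ − w μ∘[ℓ]))`.
[cite: MazurTateTeitelbaum1986Invent, §I.4 (4.2) and §I.10] [cite: Shimura1971, §3.4] -/
theorem isEigenPlusSymb_oldShape (hper : IsPeriodic μ) (heven : ∀ r : ℚ, μ (-r) = μ r)
    (hΓ : potSymbOf μ ∈ (CoeffActionOn.symPowOn (sigma0Set M) 0 k).Symb (Gamma0 M))
    (θ : ℕ → k) (hT : ∀ q : ℕ, q.Prime → ¬ q ∣ M → HeckeRel μ q (θ q))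
    (hU : ∀ q : ℕ, q.Prime → q ∣ M → ∀ r : ℚ, ∑ j ∈ Finset.range q, μ ((r + j) / q) = θ q * μ r)
    (hℓM : ¬ ℓ ∣ M) {α w : k} (hα : α ^ 2 - θ ℓ * α + ℓ = 0) (hw : w * α = 1)
    (θ' : ℕ → k) (hθ' : ∀ q : ℕ, q ≠ ℓ → θ' q = θ q) (hθ'ℓ : θ' ℓ = α) :
    IsEigenPlusSymb k (M * ℓ) θ' (potSymbOf fun r ↦ μ r - w * μ (ℓ * r)) := by
  obtain ⟨h1, h2⟩ := oldShape_mem_Symb_and_hecke hper hΓ θ hT hU hℓM hα hw θ' hθ' hθ'ℓ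
  exact ⟨h1, fun q _ hq ↦ h2 q hq, slash_iota_potSymbOf_of_even _ _ fun r ↦ by
    simp only [mul_neg, heven]⟩

/-- **THE `ℓ`-OLD EIGEN-MINUS SYMBOL** (`μ` odd): `IsEigenMinusSymb k (M * ℓ) θ' (potSymbOf (μ − w μ∘[ℓ]))`.
[cite: MazurTateTeitelbaum1986Invent, §I.4 (4.2) and §I.10] [cite: Shimura1971, §3.4] -/
theorem isEigenMinusSymb_oldShape (hper : IsPeriodic μ) (hodd : ∀ r : ℚ, μ (-r) = -μ r)
    (hΓ : potSymbOf μ ∈ (CoeffActionOn.symPowOn (sigma0Set M) 0 k).Symb (Gamma0 M))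
    (θ : ℕ → k) (hT : ∀ q : ℕ, q.Prime → ¬ q ∣ M → HeckeRel μ q (θ q))
    (hU : ∀ q : ℕ, q.Prime → q ∣ M → ∀ r : ℚ, ∑ j ∈ Finset.range q, μ ((r + j) / q) = θ q * μ r)
    (hℓM : ¬ ℓ ∣ M) {α w : k} (hα : α ^ 2 - θ ℓ * α + ℓ = 0) (hw : w * α = 1)
    (θ' : ℕ → k) (hθ' : ∀ q : ℕ, q ≠ ℓ → θ' q = θ q) (hθ'ℓ : θ' ℓ = α) :
    IsEigenMinusSymb k (M * ℓ) θ' (potSymbOf fun r ↦ μ r - w * μ (ℓ * r)) := by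
  obtain ⟨h1, h2⟩ := oldShape_mem_Symb_and_hecke hper hΓ θ hT hU hℓM hα hw θ' hθ' hθ'ℓ
  exact ⟨h1, fun q _ hq ↦ h2 q hq, slash_iota_potSymbOf_of_odd _ _ fun r ↦ by
    simp only [mul_neg, hodd]; ring⟩

/-- **(OLD) FROM ITS PUBLISHED CONTENT.** `HasOldEigenPlusSymb k (M * ℓ) θ' ℓ w μ` follows from a
`1`-periodic even LEVEL-`M` eigen-function `μ` (symbol in `Symb_{Γ₀(M)}`, MTT / Atkin–Lehner relations
with system `θ`; for `θ = θ̄_f` off `ℓ` and `θ(ℓ) ≡ ε(ℓ+1)`: the reduced symbol of Ribet's level-`M`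
form, Ribet 1990 Thm. 1.1 / `diamond1995_refinedSerre`), the root `α` with `w α = 1`, and the
NON-VANISHING `μ(r) ≠ w μ(ℓ r)` for some `r` (Ihara's lemma, Ribet 1984 Thm. 4.1).
[cite: Ribet1990, Thm. 1.1] [cite: Ribet1984ICM, Thm. 4.1] [cite: MazurTateTeitelbaum1986Invent, §I.10] -/
theorem hasOldEigenPlusSymb_of_levelLower (hper : IsPeriodic μ) (heven : ∀ r : ℚ, μ (-r) = μ r)
    (hΓ : potSymbOf μ ∈ (CoeffActionOn.symPowOn (sigma0Set M) 0 k).Symb (Gamma0 M))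
    (θ : ℕ → k) (hT : ∀ q : ℕ, q.Prime → ¬ q ∣ M → HeckeRel μ q (θ q))
    (hU : ∀ q : ℕ, q.Prime → q ∣ M → ∀ r : ℚ, ∑ j ∈ Finset.range q, μ ((r + j) / q) = θ q * μ r)
    (hℓM : ¬ ℓ ∣ M) {α w : k} (hα : α ^ 2 - θ ℓ * α + ℓ = 0) (hw : w * α = 1)
    (θ' : ℕ → k) (hθ' : ∀ q : ℕ, q ≠ ℓ → θ' q = θ q) (hθ'ℓ : θ' ℓ = α)
    (hne : ∃ r : ℚ, μ r - w * μ (ℓ * r) ≠ 0) :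
    HasOldEigenPlusSymb k (M * ℓ) θ' ℓ w μ :=
  ⟨isEigenPlusSymb_oldShape hper heven hΓ θ hT hU hℓM hα hw θ' hθ' hθ'ℓ, potSymbOf_ne_zero_iff.mpr hne⟩

/-- **(OLD⁻) FROM ITS PUBLISHED CONTENT** (odd `μ`). [cite: Ribet1990, Thm. 1.1] [cite: Ribet1984ICM, Thm. 4.1]
[cite: MazurTateTeitelbaum1986Invent, §I.10] -/
theorem hasOldEigenMinusSymb_of_levelLower (hper : IsPeriodic μ) (hodd : ∀ r : ℚ, μ (-r) = -μ r)
    (hΓ : potSymbOf μ ∈ (CoeffActionOn.symPowOn (sigma0Set M) 0 k).Symb (Gamma0 M))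
    (θ : ℕ → k) (hT : ∀ q : ℕ, q.Prime → ¬ q ∣ M → HeckeRel μ q (θ q))
    (hU : ∀ q : ℕ, q.Prime → q ∣ M → ∀ r : ℚ, ∑ j ∈ Finset.range q, μ ((r + j) / q) = θ q * μ r)
    (hℓM : ¬ ℓ ∣ M) {α w : k} (hα : α ^ 2 - θ ℓ * α + ℓ = 0) (hw : w * α = 1)
    (θ' : ℕ → k) (hθ' : ∀ q : ℕ, q ≠ ℓ → θ' q = θ q) (hθ'ℓ : θ' ℓ = α)
    (hne : ∃ r : ℚ, μ r - w * μ (ℓ * r) ≠ 0) :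
    HasOldEigenMinusSymb k (M * ℓ) θ' ℓ w μ :=
  ⟨isEigenMinusSymb_oldShape hper hodd hΓ θ hT hU hℓM hα hw θ' hθ' hθ'ℓ, potSymbOf_ne_zero_iff.mpr hne⟩

end OldShape

end Summit.BirchSwinnertonDyer.Rank1Residual.LevelLowering

end
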